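import Literature.AnabelianGeometry.EtaleTheta.Discharge.Sec5Prop55RoofsGalois
import Literature.AnabelianGeometry.EtaleTheta.Discharge.Sec5Prop55CarrierInputsGalois
import Literature.AnabelianGeometry.EtaleTheta.Discharge.Sec5Thm56OfBiKummerData
import Literature.AnabelianGeometry.EtaleTheta.Discharge.Sec5CyclotomicRigidityOfBiKummerDataLaws
import HarnessLib

/-!
# [EtTh] Prop. 5.5 / Thm. 5.6 (i) AT THE ASSEMBLED §5 DATA `ofBiKummerData` — the four carrier chain heads
# ON THE v2 SUBQUOTIENT RECORD `ThetaSubquotientProjGalois` (surjective at Galois objects only; proof-only)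

S. Mochizuki, *The étale theta function and its Frobenioid-theoretic manifestations*, Publ. RIMS **45** (2009) [MochizukiEtTh2009],
Prop. 5.5 pp.327–328 (PDF pp.101–102); Thm. 5.6 pp.328–329 (PDF pp.102–103), proof p.329 l.17–27
[cite: MochizukiEtTh2009, Prop 5.5 p.327 (PDF p.101)] [cite: MochizukiEtTh2009, Thm 5.6 p.328 (PDF p.102)].

abc-iut cell, layer L2, seat abc-iut-w5-d013 (gen 7); cone nodes EtTh:Prop5.5 / EtTh:Thm5.6(i); row «(w4-R) V1→V2 PORT OF THE PROP 5.5 /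
THM 5.6 (i) ROOF CHAIN BY ITS AUTHOR» (sequel of abc-iut-w6-d079's (w4), GAP-LEDGER G-w4d042g3-1 plan (a)).  PROOF-ONLY (0 definitions;
nothing landed is edited or restated).  The four chain heads of the Prop. 5.5 / Thm. 5.6 (i) assembly at abc-iut-L2-t4's assembled §5 data
`𝔉 := ThetaFrobenioid.ofBiKummerData …` — abc-iut-w5-d020's `cyclotomicRigidity_ofBiKummerData` (Prop. 5.5 from the sub-DAG, fixed source),
abc-iut-w5-d034's `cyclotomicRigidity_ofBiKummerData_of_laws` (P55-L06 discharged by the laws), `transportAtBN_ofBiKummerData` (T56-L09 «hBN»)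
and `cyclotomicRigidityPreserved_ofBiKummerData` (Thm. 5.6) — bind abc-iut-L2-t4's v1 record `(P : ThetaSubquotientProj 𝔉)`, which asks
`proj E` onto at EVERY base object (EMPTY at the root-model stub for `l` odd, p476337).  Here the SAME proofs are re-run VERBATIM on
abc-iut-w6-d079's v2 record `(P : ThetaSubquotientProjGalois 𝔉 Gal)` (p481123; INHABITED at every level stub, p486065), consuming the v2
generic layer (p485216, `Sec5Prop55RoofsGalois`) and the v2 carrier producers (`Sec5Prop55CarrierInputsGalois`) BY NAME; every `P`-free input
(`unitsPullComp/Id/Spec_ofBiKummerData`, `sgpCap/CupSpec_ofBiKummerData`, `sgpCapSection_ofBiKummerData`, `bijectivelyReachableFromBN_of`,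
`epi_of_model`, `ModelFrobenioid.unitsPull_congr_baseMap`) is consumed BY NAME from the v1 files.  Conclusions: the v2 statement
`P.CyclotomicRigidity hB` (twice), the `hBN` equation, and abc-iut-L2-t4's `P`-free `CyclotomicRigidityPreserved 𝔉 Ψ ρ aΨ`.

* **`cyclotomicRigidity_ofBiKummerData_galois`**, **`cyclotomicRigidity_ofBiKummerData_of_laws_galois`** (Prop. 5.5 at the carrier);
* **`transportAtBN_ofBiKummerData_galois`** (T56-L09), **`cyclotomicRigidityPreserved_ofBiKummerData_galois`** (Thm. 5.6).

HONEST FRAMING: kernel-checked implications between the cell's typed statements about the assembled §5 data; the named binders (pin `hK`,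
`hdies`, row-2 laws, `hσ`/`hgeom`/`hconst`, `hreach`/`hind`, `hgal`/`hproj`/`hcup`, the transports) are HYPOTHESES (what the genuine instance
supplies); nothing asserts that such data exist for an actual curve; [EtTh] is refereed pre-IUT material; nothing here bears on [IUTchIII]
Cor. 3.12 — no side is taken; typed ≠ proved.
-/

noncomputable section

namespace Literature.AnabelianGeometry.EtaleTheta

open CategoryTheory Opposite FrobenioidCyclotomicRigidity Literature.AlgebraicGeometry.Frobenioids

universe u₀ v₀ u v w

namespace ThetaFrobenioid

variable {K : Type u₀} [Field K]
  {X : SemiGraphs.TemperedArithmeticGroup.{u₀} K} {D₀ : Type u₀} [Category.{v₀} D₀]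
  {V : FrdIMonoidStub.{w}} {T₀ : RealifiedDivisorMonoids (D₀ := D₀) V} {D : Type u} [Category.{v} D]
  {VD : FrdICatStub.{u, v, w} D} {S : BiKummerSetting X T₀ D VD}
  {pullFrac : ∀ {A A' : S.C} (_ : A' ⟶ A), S.biratUnits A → S.biratUnits A'}
  {lv N : ℕ+} {l' : ℕ} {RD : RigidData.{max v w} N l'} {θ : S.biratUnits S.Aodot} {Bl : S.C}
  {Pl : S.FractionPair θ Bl} {Rl : S.NthRoot θ Pl lv pullFrac}
  (h : ModelFrobenioid.Hypotheses S.tf.divisorMonoid S.tf.ratFnFunctor)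
  (toB : ∀ A : S.C, S.biratUnits A →* S.tf.biratUnitsModel A) (Q : FrobenioidTheta.ThetaSubquotientStub.{w} D)
  (odd_l : Odd (lv : ℕ)) (R : S.NthRoot Rl.root Rl.pair N pullFrac) (ιX : RD.PiX ≃ₜ* X.Pi)
  (hopen : IsOpen ((S.galoisSurj R.AN.base R.αData.isGalois).ker : Set X.Pi)) (σ : Aut R.AN.base →* Aut R.AN)
  (K' : Type w) [Field K'] (constEmb : K'ˣ →* S.tf.biratUnitsModel R.BN)
  (constEmb_injective : Function.Injective constEmb)
  (hdivc : ∀ g : Aut R.BN.base,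
    ModelFrobenioid.div ((σ ((BiKummerSetting.NthRoot.baseIso S R).conjAut.symm g)).hom ≫ R.pair.num) =
      ModelFrobenioid.div R.pair.num)
  (hdivp : ∀ y : RD.PiYdd,
    ModelFrobenioid.div ((σ (S.galoisSurj R.AN.base R.αData.isGalois (ιX y.1))).hom ≫ R.pair.den) =
      ModelFrobenioid.div R.pair.den)
  {Gal : D → Prop}

/-- (v2 record; abc-iut-w5-d020's `cyclotomicRigidity_ofBiKummerData` VERBATIM, concluding the v2 statement `ThetaSubquotientProjGalois.CyclotomicRigidity`.)
**[EtTh] Proposition 5.5 (Frobenioid-theoretic Cyclotomic Rigidity) for the ASSEMBLED §5 data, on the v2 record** — abc-iut-L2-t4's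
`CyclotomicRigidity (ofBiKummerData …) P hB` (existence ∧ uniqueness of a rigidity family that is Kummer-determined on
`B_N` and functorial for linear morphisms of `(l, N)`-theta-saturated objects), from the sub-DAG pieces (module
docstring), MODULO the named inputs `hK` (ν-half of the Prop. 5.2 (iii) pin), `hdies`, `e`/`he`, `hlift`/`hpre`/`hP`
(row-2 laws), `hσ`, `hgeom`, `hconst`, `hreach` (t4's transport step at the data), `hind` (P55-L06), `hLc`/`hLi` (laws of
the free subquotient stub `Q`).  [cite: MochizukiEtTh2009, Prop 5.5 p.327–328 (PDF pp.101–102)] -/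
theorem cyclotomicRigidity_ofBiKummerData_galois
    (hB : (ofBiKummerData h toB Q odd_l R ιX hopen σ K' constEmb constEmb_injective hdivc hdivp).IsThetaSaturated
      (ofBiKummerData h toB Q odd_l R ιX hopen σ K' constEmb constEmb_injective hdivc hdivp).BN)
    (P : ThetaSubquotientProjGalois (ofBiKummerData h toB Q odd_l R ιX hopen σ K' constEmb constEmb_injective hdivc hdivp) Gal)
    -- the η-side (abc-iut-w5-d123, P55-L02 at the carrier) and coverage
    {η₀ : RD.PiYdd → RD.mu} (hη₀ : η₀ ∈ RD.thetaCocycles)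
    (hdies : ∀ k : RD.PiYdd, rhoOfBiKummerData R ιX k = 1 → η₀ k = 1)
    (e : RD.mu → (ofBiKummerData h toB Q odd_l R ιX hopen σ K' constEmb constEmb_injective hdivc hdivp).lDeltaModN
      (ofBiKummerData h toB Q odd_l R ιX hopen σ K' constEmb constEmb_injective hdivc hdivp).BN)
    (he : Function.Surjective e)
    (hlift : ∀ a ∈ (ofBiKummerData h toB Q odd_l R ιX hopen σ K' constEmb constEmb_injective hdivc hdivp).HB,
      a ∈ P.pre _ → ∃ k : RD.PiYdd, (k : RD.PiX) ∈ RD.lDeltaTheta ∧ rhoOfBiKummerData R ιX k = a)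
    (hpre : ∀ k : RD.PiYdd, (k : RD.PiX) ∈ RD.lDeltaTheta → rhoOfBiKummerData R ιX k ∈ P.pre _)
    (hP : ∀ (k : RD.PiYdd) (hk : (k : RD.PiX) ∈ RD.lDeltaTheta) (hm : rhoOfBiKummerData R ιX k ∈ P.pre _),
      (QuotientGroup.mk (P.proj _ ⟨rhoOfBiKummerData R ιX k, hm⟩) :
          (ofBiKummerData h toB Q odd_l R ιX hopen σ K' constEmb constEmb_injective hdivc hdivp).lDeltaModN
            (ofBiKummerData h toB Q odd_l R ιX hopen σ K' constEmb constEmb_injective hdivc hdivp).BN) =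
        e (RD.thetaMod ⟨k, hk⟩))
    -- the ν-half of the Prop. 5.2 (iii) pin, for the descended η
    (ν : (ofBiKummerData h toB Q odd_l R ιX hopen σ K' constEmb constEmb_injective hdivc hdivp).lDeltaModN
        (ofBiKummerData h toB Q odd_l R ιX hopen σ K' constEmb constEmb_injective hdivc hdivp).BN ≃*
      (ofBiKummerData h toB Q odd_l R ιX hopen σ K' constEmb constEmb_injective hdivc hdivp).muTorsion
        (ofBiKummerData h toB Q odd_l R ιX hopen σ K' constEmb constEmb_injective hdivc hdivp).BN
        (ofBiKummerData h toB Q odd_l R ιX hopen σ K' constEmb constEmb_injective hdivc hdivp).N)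
    (hK : ∀ η : (ofBiKummerData h toB Q odd_l R ιX hopen σ K' constEmb constEmb_injective hdivc hdivp).HB →
        (ofBiKummerData h toB Q odd_l R ιX hopen σ K' constEmb constEmb_injective hdivc hdivp).lDeltaModN
          (ofBiKummerData h toB Q odd_l R ιX hopen σ K' constEmb constEmb_injective hdivc hdivp).BN,
      (∀ k : RD.PiYdd, η ⟨rhoOfBiKummerData R ιX k, Subgroup.mem_map_of_mem _ k.2⟩ = e (η₀ k)) →
        FrobenioidThetaBiKummer.ThetaPairKummerClass
          (ofBiKummerData h toB Q odd_l R ιX hopen σ K' constEmb constEmb_injective hdivc hdivp) η ν)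
    -- centrality of the geometric part (this seat, T56-L09b at the data)
    (hσ : ∀ g : Aut R.AN.base, ModelFrobenioid.baseMap (σ g).hom = g.hom)
    (hgeom : P.pre R.BN.base ≤ RD.aug.ker.map (rhoOfBiKummerData R ιX))
    (hconst : ∀ δ ∈ RD.aug.ker, ∀ τ : ModelFrobenioid.units R.BN,
      (S.tf.ratFnFunctor.map (rhoOfBiKummerData R ιX δ).hom.op).hom (ModelFrobenioid.unit τ.1.hom) =
        ModelFrobenioid.unit τ.1.hom)
    -- the transport step and its independence, the laws of the free subquotient stub
    (hreach : LinearlyReachableFromBN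
      (ofBiKummerData h toB Q odd_l R ιX hopen σ K' constEmb constEmb_injective hdivc hdivp))
    (hind : Thm56Sub.TransportIndependent
      (ofBiKummerData h toB Q odd_l R ιX hopen σ K' constEmb constEmb_injective hdivc hdivp) ν)
    (hLc : Thm56Sub.LDeltaMapComp
      (ofBiKummerData h toB Q odd_l R ιX hopen σ K' constEmb constEmb_injective hdivc hdivp))
    (hLi : Thm56Sub.LDeltaMapId
      (ofBiKummerData h toB Q odd_l R ιX hopen σ K' constEmb constEmb_injective hdivc hdivp)) :
    P.CyclotomicRigidity hB := by
  -- the descended, tautological η (abc-iut-w5-d123)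
  obtain ⟨η, hηdesc, hηtaut⟩ := exists_eta_etaTautological_ofBiKummerData_galois h toB Q odd_l R ιX hopen σ K' constEmb
    constEmb_injective hdivc hdivp hη₀ hdies e P hlift hP
  exact Thm56Sub.cyclotomicRigidity_of_sub_galois P hB (hK η hηdesc) hηtaut
    (unitsCentralUnderLDelta_ofBiKummerData_galois h toB Q odd_l R ιX hopen σ K' constEmb constEmb_injective hdivc hdivp
      hσ P hgeom hconst)
    (Thm56Sub.bijectivelyReachableFromBN_of _ hB hreach) hind
    (unitsPullComp_ofBiKummerData h toB Q odd_l R ιX hopen σ K' constEmb constEmb_injective hdivc hdivp)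
    (unitsPullId_ofBiKummerData h toB Q odd_l R ιX hopen σ K' constEmb constEmb_injective hdivc hdivp) hLc hLi
    (lDeltaCovered_ofBiKummerData_galois h toB Q odd_l R ιX hopen σ K' constEmb constEmb_injective hdivc hdivp e he P hpre hP)

/-- (v2 record; abc-iut-w5-d034's `cyclotomicRigidity_ofBiKummerData_of_laws` VERBATIM.)
**[EtTh] Proposition 5.5 for the ASSEMBLED §5 data, P55-L06 discharged, on the v2 record** — `CyclotomicRigidity (ofBiKummerData …) P hB`
exactly as `cyclotomicRigidity_ofBiKummerData` but WITHOUT the transport-independence binder `hind`: it is derived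
(abc-iut-w4-d008's `Thm56Sub.cyclotomicRigidity_of_laws` / `transportIndependent_of_thetaPair`) from the theta-pair
Kummer shape `hK`, the laws (U) (`ModelFrobenioid.unitsPull_congr_baseMap`), (S) (`sgpCapSection_ofBiKummerData`),
`unitsPullSpec_ofBiKummerData`, and the three NAMED structural binders `hgal`, `hproj`, `hcup` (module docstring).
[cite: MochizukiEtTh2009, Prop 5.5 p.327–328 (PDF pp.101–102)] -/
theorem cyclotomicRigidity_ofBiKummerData_of_laws_galois
    (hB : (ofBiKummerData h toB Q odd_l R ιX hopen σ K' constEmb constEmb_injective hdivc hdivp).IsThetaSaturated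
      (ofBiKummerData h toB Q odd_l R ιX hopen σ K' constEmb constEmb_injective hdivc hdivp).BN)
    (P : ThetaSubquotientProjGalois (ofBiKummerData h toB Q odd_l R ιX hopen σ K' constEmb constEmb_injective hdivc hdivp) Gal)
    -- the η-side (abc-iut-w5-d123, P55-L02 at the carrier) and coverage
    {η₀ : RD.PiYdd → RD.mu} (hη₀ : η₀ ∈ RD.thetaCocycles)
    (hdies : ∀ k : RD.PiYdd, rhoOfBiKummerData R ιX k = 1 → η₀ k = 1)
    (e : RD.mu → (ofBiKummerData h toB Q odd_l R ιX hopen σ K' constEmb constEmb_injective hdivc hdivp).lDeltaModN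
      (ofBiKummerData h toB Q odd_l R ιX hopen σ K' constEmb constEmb_injective hdivc hdivp).BN)
    (he : Function.Surjective e)
    (hlift : ∀ a ∈ (ofBiKummerData h toB Q odd_l R ιX hopen σ K' constEmb constEmb_injective hdivc hdivp).HB,
      a ∈ P.pre _ → ∃ k : RD.PiYdd, (k : RD.PiX) ∈ RD.lDeltaTheta ∧ rhoOfBiKummerData R ιX k = a)
    (hpre : ∀ k : RD.PiYdd, (k : RD.PiX) ∈ RD.lDeltaTheta → rhoOfBiKummerData R ιX k ∈ P.pre _)
    (hP : ∀ (k : RD.PiYdd) (hk : (k : RD.PiX) ∈ RD.lDeltaTheta) (hm : rhoOfBiKummerData R ιX k ∈ P.pre _),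
      (QuotientGroup.mk (P.proj _ ⟨rhoOfBiKummerData R ιX k, hm⟩) :
          (ofBiKummerData h toB Q odd_l R ιX hopen σ K' constEmb constEmb_injective hdivc hdivp).lDeltaModN
            (ofBiKummerData h toB Q odd_l R ιX hopen σ K' constEmb constEmb_injective hdivc hdivp).BN) =
        e (RD.thetaMod ⟨k, hk⟩))
    -- the ν-half of the Prop. 5.2 (iii) pin, for the descended η
    (ν : (ofBiKummerData h toB Q odd_l R ιX hopen σ K' constEmb constEmb_injective hdivc hdivp).lDeltaModN
        (ofBiKummerData h toB Q odd_l R ιX hopen σ K' constEmb constEmb_injective hdivc hdivp).BN ≃*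
      (ofBiKummerData h toB Q odd_l R ιX hopen σ K' constEmb constEmb_injective hdivc hdivp).muTorsion
        (ofBiKummerData h toB Q odd_l R ιX hopen σ K' constEmb constEmb_injective hdivc hdivp).BN
        (ofBiKummerData h toB Q odd_l R ιX hopen σ K' constEmb constEmb_injective hdivc hdivp).N)
    (hK : ∀ η : (ofBiKummerData h toB Q odd_l R ιX hopen σ K' constEmb constEmb_injective hdivc hdivp).HB →
        (ofBiKummerData h toB Q odd_l R ιX hopen σ K' constEmb constEmb_injective hdivc hdivp).lDeltaModN
          (ofBiKummerData h toB Q odd_l R ιX hopen σ K' constEmb constEmb_injective hdivc hdivp).BN,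
      (∀ k : RD.PiYdd, η ⟨rhoOfBiKummerData R ιX k, Subgroup.mem_map_of_mem _ k.2⟩ = e (η₀ k)) →
        FrobenioidThetaBiKummer.ThetaPairKummerClass
          (ofBiKummerData h toB Q odd_l R ιX hopen σ K' constEmb constEmb_injective hdivc hdivp) η ν)
    -- centrality of the geometric part (this seat, T56-L09b at the data)
    (hσ : ∀ g : Aut R.AN.base, ModelFrobenioid.baseMap (σ g).hom = g.hom)
    (hgeom : P.pre R.BN.base ≤ RD.aug.ker.map (rhoOfBiKummerData R ιX))
    (hconst : ∀ δ ∈ RD.aug.ker, ∀ τ : ModelFrobenioid.units R.BN,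
      (S.tf.ratFnFunctor.map (rhoOfBiKummerData R ιX δ).hom.op).hom (ModelFrobenioid.unit τ.1.hom) =
        ModelFrobenioid.unit τ.1.hom)
    -- the transport step and its independence, the laws of the free subquotient stub
    (hreach : LinearlyReachableFromBN
      (ofBiKummerData h toB Q odd_l R ιX hopen σ K' constEmb constEmb_injective hdivc hdivp))
    (hLc : Thm56Sub.LDeltaMapComp
      (ofBiKummerData h toB Q odd_l R ιX hopen σ K' constEmb constEmb_injective hdivc hdivp))
    (hLi : Thm56Sub.LDeltaMapId
      (ofBiKummerData h toB Q odd_l R ιX hopen σ K' constEmb constEmb_injective hdivc hdivp))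
    -- the three structural leaves of abc-iut-w4-d008's `cyclotomicRigidity_of_laws` that stay NAMED at the data
    (hgal : ∀ (T : S.C),
      (ofBiKummerData h toB Q odd_l R ιX hopen σ K' constEmb constEmb_injective hdivc hdivp).IsThetaSaturated T →
      ∀ (φ φ' : (ofBiKummerData h toB Q odd_l R ιX hopen σ K' constEmb constEmb_injective hdivc hdivp).BN ⟶ T),
        (ofBiKummerData h toB Q odd_l R ιX hopen σ K' constEmb constEmb_injective hdivc hdivp).IsLinear φ →
        (ofBiKummerData h toB Q odd_l R ιX hopen σ K' constEmb constEmb_injective hdivc hdivp).IsLinear φ' →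
          ∃ g : Aut ((ofBiKummerData h toB Q odd_l R ιX hopen σ K' constEmb constEmb_injective hdivc hdivp).base.obj
              (ofBiKummerData h toB Q odd_l R ιX hopen σ K' constEmb constEmb_injective hdivc hdivp).BN),
            (ofBiKummerData h toB Q odd_l R ιX hopen σ K' constEmb constEmb_injective hdivc hdivp).base.map φ' =
              g.hom ≫ (ofBiKummerData h toB Q odd_l R ιX hopen σ K' constEmb constEmb_injective hdivc hdivp).base.map φ)
    (hproj : ∀ (g g' : Aut ((ofBiKummerData h toB Q odd_l R ιX hopen σ K' constEmb constEmb_injective hdivc hdivp).base.obj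
        (ofBiKummerData h toB Q odd_l R ιX hopen σ K' constEmb constEmb_injective hdivc hdivp).BN))
        (hh : g' ∈ P.pre _), ∃ hgh : g * g' * g⁻¹ ∈ P.pre _,
          (ofBiKummerData h toB Q odd_l R ιX hopen σ K' constEmb constEmb_injective hdivc hdivp).lDeltaMap g.hom
              (P.proj _ ⟨g', hh⟩) = P.proj _ ⟨g * g' * g⁻¹, hgh⟩)
    (hcup : ∀ (g : Aut ((ofBiKummerData h toB Q odd_l R ιX hopen σ K' constEmb constEmb_injective hdivc hdivp).base.obj
        (ofBiKummerData h toB Q odd_l R ιX hopen σ K' constEmb constEmb_injective hdivc hdivp).BN))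
        (k : (ofBiKummerData h toB Q odd_l R ιX hopen σ K' constEmb constEmb_injective hdivc hdivp).HB),
        (k : Aut ((ofBiKummerData h toB Q odd_l R ιX hopen σ K' constEmb constEmb_injective hdivc hdivp).base.obj
          (ofBiKummerData h toB Q odd_l R ιX hopen σ K' constEmb constEmb_injective hdivc hdivp).BN)) ∈ P.pre _ →
        ∃ hmem : g * (k : Aut ((ofBiKummerData h toB Q odd_l R ιX hopen σ K' constEmb constEmb_injective hdivc hdivp).base.obj
            (ofBiKummerData h toB Q odd_l R ιX hopen σ K' constEmb constEmb_injective hdivc hdivp).BN)) * g⁻¹ ∈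
            (ofBiKummerData h toB Q odd_l R ιX hopen σ K' constEmb constEmb_injective hdivc hdivp).HB,
          (ofBiKummerData h toB Q odd_l R ιX hopen σ K' constEmb constEmb_injective hdivc hdivp).sgpCup
              ⟨g * (k : Aut ((ofBiKummerData h toB Q odd_l R ιX hopen σ K' constEmb constEmb_injective hdivc hdivp).base.obj
                (ofBiKummerData h toB Q odd_l R ιX hopen σ K' constEmb constEmb_injective hdivc hdivp).BN)) * g⁻¹, hmem⟩ =
            (ofBiKummerData h toB Q odd_l R ιX hopen σ K' constEmb constEmb_injective hdivc hdivp).sgpCap g *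
              (ofBiKummerData h toB Q odd_l R ιX hopen σ K' constEmb constEmb_injective hdivc hdivp).sgpCup k *
              ((ofBiKummerData h toB Q odd_l R ιX hopen σ K' constEmb constEmb_injective hdivc hdivp).sgpCap g)⁻¹) :
    P.CyclotomicRigidity hB := by
  -- the descended, tautological η (abc-iut-w5-d123)
  obtain ⟨η, hηdesc, hηtaut⟩ := exists_eta_etaTautological_ofBiKummerData_galois h toB Q odd_l R ιX hopen σ K' constEmb
    constEmb_injective hdivc hdivp hη₀ hdies e P hlift hP
  exact Thm56Sub.cyclotomicRigidity_of_laws_galois P hB (hK η hηdesc) hηtaut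
    (unitsCentralUnderLDelta_ofBiKummerData_galois h toB Q odd_l R ιX hopen σ K' constEmb constEmb_injective hdivc hdivp
      hσ P hgeom hconst)
    (Thm56Sub.bijectivelyReachableFromBN_of _ hB hreach)
    (unitsPullComp_ofBiKummerData h toB Q odd_l R ιX hopen σ K' constEmb constEmb_injective hdivc hdivp)
    (unitsPullId_ofBiKummerData h toB Q odd_l R ιX hopen σ K' constEmb constEmb_injective hdivc hdivp) hLc hLi
    (unitsPullSpec_ofBiKummerData h toB Q odd_l R ιX hopen σ K' constEmb constEmb_injective hdivc hdivp)
    (lDeltaCovered_ofBiKummerData_galois h toB Q odd_l R ιX hopen σ K' constEmb constEmb_injective hdivc hdivp e he P hpre hP)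
    hgal (sgpCapSection_ofBiKummerData h toB Q odd_l R ιX hopen σ K' constEmb constEmb_injective hdivc hdivp hσ)
    (fun _ _ _ _ hb => ModelFrobenioid.unitsPull_congr_baseMap hb) hproj hcup

/-- (v2 record; abc-iut-w5-d034's `transportAtBN_ofBiKummerData` VERBATIM.)
**T56-L09 («hBN») at the assembled §5 data, on the v2 record**: for a self-equivalence `Ψ` of the tempered Frobenioid transported to
`A_N`, `B_N` (`α`, `β`, `eA`, `Dp`, base shadow `θΨ`) compatibly with the sections and the theta structure, and a
rigidity family `ρ` with the Prop. 5.5 properties, `Ψ(ρ_{B_N}(x)) = ρ_{Ψ B_N}(aΨ_{B_N} x)` on `(l·Δ_Θ)_{B_N} ⊗ ℤ/N` —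
abc-iut-w5-d020's `Thm56Sub.transportAtBN_of` with total epimorphicity, the section relations, units-centrality
(T56-L09b), `UnitsPullSpec`, `DeltaTransportCompat` (T56-L09c, abc-iut-w5-d013) and coverage discharged by name.
[cite: MochizukiEtTh2009, Thm 5.6 proof p.329 (PDF p.103)] -/
theorem transportAtBN_ofBiKummerData_galois
    (Ψ : S.C ≌ S.C) (α : Ψ.functor.obj (ofBiKummerData h toB Q odd_l R ιX hopen σ K' constEmb constEmb_injective hdivc hdivp).AN ≅ (ofBiKummerData h toB Q odd_l R ιX hopen σ K' constEmb constEmb_injective hdivc hdivp).AN)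
    (β : Ψ.functor.obj (ofBiKummerData h toB Q odd_l R ιX hopen σ K' constEmb constEmb_injective hdivc hdivp).BN ≅ (ofBiKummerData h toB Q odd_l R ιX hopen σ K' constEmb constEmb_injective hdivc hdivp).BN)
    (eA : (ofBiKummerData h toB Q odd_l R ιX hopen σ K' constEmb constEmb_injective hdivc hdivp).AN ≅ (ofBiKummerData h toB Q odd_l R ιX hopen σ K' constEmb constEmb_injective hdivc hdivp).AN) (Dp : Aut (ofBiKummerData h toB Q odd_l R ιX hopen σ K' constEmb constEmb_injective hdivc hdivp).BN)
    (θΨ : Aut R.BN.base ≃* Aut R.BN.base)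
    (hdiff : (ofBiKummerData h toB Q odd_l R ιX hopen σ K' constEmb constEmb_injective hdivc hdivp).BiKummerDifferenceMem)
    (hT : α.inv ≫ Ψ.functor.map (ofBiKummerData h toB Q odd_l R ιX hopen σ K' constEmb constEmb_injective hdivc hdivp).sCap ≫ β.hom =
      eA.hom ≫ (ofBiKummerData h toB Q odd_l R ιX hopen σ K' constEmb constEmb_injective hdivc hdivp).sCap ≫ (1 : Aut (ofBiKummerData h toB Q odd_l R ιX hopen σ K' constEmb constEmb_injective hdivc hdivp).BN).hom)
    (hT' : α.inv ≫ Ψ.functor.map (ofBiKummerData h toB Q odd_l R ιX hopen σ K' constEmb constEmb_injective hdivc hdivp).sCup ≫ β.hom =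
      eA.hom ≫ (ofBiKummerData h toB Q odd_l R ιX hopen σ K' constEmb constEmb_injective hdivc hdivp).sCup ≫ Dp.hom)
    (hu : Dp ∈ (ofBiKummerData h toB Q odd_l R ιX hopen σ K' constEmb constEmb_injective hdivc hdivp).units (ofBiKummerData h toB Q odd_l R ιX hopen σ K' constEmb constEmb_injective hdivc hdivp).BN)
    (hstrv : (ofBiKummerData h toB Q odd_l R ιX hopen σ K' constEmb constEmb_injective hdivc hdivp).StrvTransport Ψ α eA θΨ)
    (hYdd : (ofBiKummerData h toB Q odd_l R ιX hopen σ K' constEmb constEmb_injective hdivc hdivp).HB.map θΨ.toMonoidHom = (ofBiKummerData h toB Q odd_l R ιX hopen σ K' constEmb constEmb_injective hdivc hdivp).HB)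
    (P : ThetaSubquotientProjGalois (ofBiKummerData h toB Q odd_l R ιX hopen σ K' constEmb constEmb_injective hdivc hdivp) Gal)
    -- centrality of the geometric part (T56-L09b at the data)
    (hσ : ∀ g : Aut R.AN.base, ModelFrobenioid.baseMap (σ g).hom = g.hom)
    (hgeom : P.pre R.BN.base ≤ RD.aug.ker.map (rhoOfBiKummerData R ιX))
    (hconst : ∀ δ ∈ RD.aug.ker, ∀ τ : ModelFrobenioid.units R.BN,
      (S.tf.ratFnFunctor.map (rhoOfBiKummerData R ιX δ).hom.op).hom (ModelFrobenioid.unit τ.1.hom) =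
        ModelFrobenioid.unit τ.1.hom)
    -- the row-2 laws of the subquotient datum and coverage (abc-iut-w5-d123 / abc-iut-w5-d013 shapes, verbatim)
    (e : RD.mu → (ofBiKummerData h toB Q odd_l R ιX hopen σ K' constEmb constEmb_injective hdivc hdivp).lDeltaModN (ofBiKummerData h toB Q odd_l R ιX hopen σ K' constEmb constEmb_injective hdivc hdivp).BN)
    (he : Function.Surjective e)
    (hpre : ∀ k : RD.PiYdd, (k : RD.PiX) ∈ RD.lDeltaTheta → rhoOfBiKummerData R ιX k ∈ P.pre _)
    (hP : ∀ (k : RD.PiYdd) (hk : (k : RD.PiX) ∈ RD.lDeltaTheta) (hm : rhoOfBiKummerData R ιX k ∈ P.pre _),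
      (QuotientGroup.mk (P.proj _ ⟨rhoOfBiKummerData R ιX k, hm⟩) : (ofBiKummerData h toB Q odd_l R ιX hopen σ K' constEmb constEmb_injective hdivc hdivp).lDeltaModN (ofBiKummerData h toB Q odd_l R ιX hopen σ K' constEmb constEmb_injective hdivc hdivp).BN) = e (RD.thetaMod ⟨k, hk⟩))
    (hcov' : ∀ g ∈ P.pre ((ofBiKummerData h toB Q odd_l R ιX hopen σ K' constEmb constEmb_injective hdivc hdivp).base.obj (ofBiKummerData h toB Q odd_l R ιX hopen σ K' constEmb constEmb_injective hdivc hdivp).BN),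
      ∃ k : RD.PiYdd, (k : RD.PiX) ∈ RD.lDeltaTheta ∧ rhoOfBiKummerData R ιX k = g)
    -- T56-L09c data (abc-iut-w5-d013): Ψ on (l·Δ_Θ) ⊗ ℤ/N and the printed relations
    (aΨ : ∀ A : S.C, (ofBiKummerData h toB Q odd_l R ιX hopen σ K' constEmb constEmb_injective hdivc hdivp).lDeltaModN A ≃* (ofBiKummerData h toB Q odd_l R ιX hopen σ K' constEmb constEmb_injective hdivc hdivp).lDeltaModN (Ψ.functor.obj A))
    (γ : RD.PiX ≃ₜ* RD.PiX)
    (hγ : ∀ y : RD.PiX, θΨ (rhoOfBiKummerData R ιX y) = rhoOfBiKummerData R ιX (γ y))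
    (hγL : RD.lDeltaTheta.map γ.toMulEquiv.toMonoidHom = RD.lDeltaTheta)
    (haΨ : ∀ (k : RD.PiYdd) (hk : (k : RD.PiX) ∈ RD.lDeltaTheta) (hk' : γ k ∈ RD.lDeltaTheta),
      (ofBiKummerData h toB Q odd_l R ιX hopen σ K' constEmb constEmb_injective hdivc hdivp).lDeltaModNMap β.hom (aΨ _ (e (RD.thetaMod ⟨k, hk⟩))) = e (RD.thetaMod ⟨γ k, hk'⟩))
    -- the rigidity family with its Prop. 5.5 properties
    (ρ : RigidityFamily (ofBiKummerData h toB Q odd_l R ιX hopen σ K' constEmb constEmb_injective hdivc hdivp))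
    (hB : (ofBiKummerData h toB Q odd_l R ιX hopen σ K' constEmb constEmb_injective hdivc hdivp).IsThetaSaturated (ofBiKummerData h toB Q odd_l R ιX hopen σ K' constEmb constEmb_injective hdivc hdivp).BN)
    (hK : P.IsKummerDetermined ρ hB) (hρ : IsFunctorialLinear (ofBiKummerData h toB Q odd_l R ιX hopen σ K' constEmb constEmb_injective hdivc hdivp) ρ)
    (hΨB : (ofBiKummerData h toB Q odd_l R ιX hopen σ K' constEmb constEmb_injective hdivc hdivp).IsThetaSaturated (Ψ.functor.obj (ofBiKummerData h toB Q odd_l R ιX hopen σ K' constEmb constEmb_injective hdivc hdivp).BN))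
    (x : (ofBiKummerData h toB Q odd_l R ιX hopen σ K' constEmb constEmb_injective hdivc hdivp).lDeltaModN (ofBiKummerData h toB Q odd_l R ιX hopen σ K' constEmb constEmb_injective hdivc hdivp).BN) :
    (Ψ.functor.mapAut (ofBiKummerData h toB Q odd_l R ιX hopen σ K' constEmb constEmb_injective hdivc hdivp).BN (ρ (ofBiKummerData h toB Q odd_l R ιX hopen σ K' constEmb constEmb_injective hdivc hdivp).BN hB x : Aut (ofBiKummerData h toB Q odd_l R ιX hopen σ K' constEmb constEmb_injective hdivc hdivp).BN) : Aut (Ψ.functor.obj (ofBiKummerData h toB Q odd_l R ιX hopen σ K' constEmb constEmb_injective hdivc hdivp).BN)) =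
      ρ (Ψ.functor.obj (ofBiKummerData h toB Q odd_l R ιX hopen σ K' constEmb constEmb_injective hdivc hdivp).BN) hΨB (aΨ (ofBiKummerData h toB Q odd_l R ιX hopen σ K' constEmb constEmb_injective hdivc hdivp).BN x) := by
  haveI : Epi (ofBiKummerData h toB Q odd_l R ιX hopen σ K' constEmb constEmb_injective hdivc hdivp).sCap := epi_of_model (DivB := S.tf.divBNatTrans) h _
  haveI : Epi (ofBiKummerData h toB Q odd_l R ιX hopen σ K' constEmb constEmb_injective hdivc hdivp).sCup := epi_of_model (DivB := S.tf.divBNatTrans) h _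
  exact Thm56Sub.transportAtBN_of_galois Ψ α β eA Dp θΨ
    (sgpCapSpec_ofBiKummerData h toB Q odd_l R ιX hopen σ K' constEmb constEmb_injective hdivc hdivp)
    (sgpCupSpec_ofBiKummerData h toB Q odd_l R ιX hopen σ K' constEmb constEmb_injective hdivc hdivp)
    hdiff hT hT' hu hstrv hYdd P
    (unitsCentralUnderLDelta_ofBiKummerData_galois h toB Q odd_l R ιX hopen σ K' constEmb constEmb_injective hdivc hdivp
      hσ P hgeom hconst)
    (unitsPullSpec_ofBiKummerData h toB Q odd_l R ιX hopen σ K' constEmb constEmb_injective hdivc hdivp) aΨ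
    (Thm56Sub.deltaTransportCompat_ofBiKummerData_galois h toB Q odd_l R ιX hopen σ K' constEmb constEmb_injective hdivc hdivp e P hpre
      hP hcov' Ψ β aΨ θΨ γ hγ hγL haΨ)
    ρ hB hK hρ
    (lDeltaCovered_ofBiKummerData_galois h toB Q odd_l R ιX hopen σ K' constEmb constEmb_injective hdivc hdivp e he P hpre hP)
    hΨB x

/-- (v2 record; abc-iut-w5-d034's `cyclotomicRigidityPreserved_ofBiKummerData` VERBATIM; conclusion `P`-free.)
**[EtTh] Theorem 5.6 at the assembled §5 data, `P` read on the v2 record** — abc-iut-L2-t4's `CyclotomicRigidityPreserved (ofBiKummerData …) Ψ ρ aΨ`: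
a self-equivalence `Ψ` of the tempered Frobenioid (with base shadow `Ψbs`, transported to `A_N`, `B_N` compatibly with
the sections and the theta structure, linear, natural for `aΨ` and the μ-pulls) PRESERVES the rigidity family `ρ` of
Prop. 5.5 — from `Thm56Sub.cyclotomicRigidityPreserved_of_sub` with total epimorphicity, the section relations,
units-centrality (T56-L09b), `UnitsPullSpec`, `DeltaTransportCompat` (T56-L09c) and coverage discharged by name.
[cite: MochizukiEtTh2009, Thm 5.6 p.328–329 (PDF pp.102–103)] -/
theorem cyclotomicRigidityPreserved_ofBiKummerData_galois
    (Ψ : S.C ≌ S.C) (Ψbs : D ⥤ D) [Ψbs.Faithful] (eΨ : Ψ.functor ⋙ (ofBiKummerData h toB Q odd_l R ιX hopen σ K' constEmb constEmb_injective hdivc hdivp).base ≅ (ofBiKummerData h toB Q odd_l R ιX hopen σ K' constEmb constEmb_injective hdivc hdivp).base ⋙ Ψbs)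
    (α : Ψ.functor.obj (ofBiKummerData h toB Q odd_l R ιX hopen σ K' constEmb constEmb_injective hdivc hdivp).AN ≅ (ofBiKummerData h toB Q odd_l R ιX hopen σ K' constEmb constEmb_injective hdivc hdivp).AN)
    (β : Ψ.functor.obj (ofBiKummerData h toB Q odd_l R ιX hopen σ K' constEmb constEmb_injective hdivc hdivp).BN ≅ (ofBiKummerData h toB Q odd_l R ιX hopen σ K' constEmb constEmb_injective hdivc hdivp).BN)
    (eA : (ofBiKummerData h toB Q odd_l R ιX hopen σ K' constEmb constEmb_injective hdivc hdivp).AN ≅ (ofBiKummerData h toB Q odd_l R ιX hopen σ K' constEmb constEmb_injective hdivc hdivp).AN) (Dp : Aut (ofBiKummerData h toB Q odd_l R ιX hopen σ K' constEmb constEmb_injective hdivc hdivp).BN)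
    (θΨ : Aut R.BN.base ≃* Aut R.BN.base)
    (aΨ : ∀ A : S.C, (ofBiKummerData h toB Q odd_l R ιX hopen σ K' constEmb constEmb_injective hdivc hdivp).lDeltaModN A ≃* (ofBiKummerData h toB Q odd_l R ιX hopen σ K' constEmb constEmb_injective hdivc hdivp).lDeltaModN (Ψ.functor.obj A))
    -- abc-iut-L2-d4's transport hypotheses on Ψ
    (hlin : PreFrobenioidData.PreservesMor Ψ.functor (ofBiKummerData h toB Q odd_l R ιX hopen σ K' constEmb constEmb_injective hdivc hdivp).IsLinear (ofBiKummerData h toB Q odd_l R ιX hopen σ K' constEmb constEmb_injective hdivc hdivp).IsLinear)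
    (haΨn : ∀ {A A' : S.C} (φ : A ⟶ A') (x : (ofBiKummerData h toB Q odd_l R ιX hopen σ K' constEmb constEmb_injective hdivc hdivp).lDeltaModN A),
      aΨ A' ((ofBiKummerData h toB Q odd_l R ιX hopen σ K' constEmb constEmb_injective hdivc hdivp).lDeltaModNMap φ x) = (ofBiKummerData h toB Q odd_l R ιX hopen σ K' constEmb constEmb_injective hdivc hdivp).lDeltaModNMap (Ψ.functor.map φ) (aΨ A x))
    (hpull : ∀ {A A' : S.C} (φ : A ⟶ A') (u : (ofBiKummerData h toB Q odd_l R ιX hopen σ K' constEmb constEmb_injective hdivc hdivp).muTorsion A' (ofBiKummerData h toB Q odd_l R ιX hopen σ K' constEmb constEmb_injective hdivc hdivp).N)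
      (hu : Ψ.functor.mapAut A' (u : Aut A') ∈ (ofBiKummerData h toB Q odd_l R ιX hopen σ K' constEmb constEmb_injective hdivc hdivp).muTorsion (Ψ.functor.obj A') (ofBiKummerData h toB Q odd_l R ιX hopen σ K' constEmb constEmb_injective hdivc hdivp).N),
      Ψ.functor.mapAut A ((ofBiKummerData h toB Q odd_l R ιX hopen σ K' constEmb constEmb_injective hdivc hdivp).muTorsionPull φ (ofBiKummerData h toB Q odd_l R ιX hopen σ K' constEmb constEmb_injective hdivc hdivp).N u : Aut A) =
        ((ofBiKummerData h toB Q odd_l R ιX hopen σ K' constEmb constEmb_injective hdivc hdivp).muTorsionPull (Ψ.functor.map φ) (ofBiKummerData h toB Q odd_l R ιX hopen σ K' constEmb constEmb_injective hdivc hdivp).N ⟨_, hu⟩ : Aut (Ψ.functor.obj A)))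
    (hreach : LinearlyReachableFromBN (ofBiKummerData h toB Q odd_l R ιX hopen σ K' constEmb constEmb_injective hdivc hdivp))
    (hdiff : (ofBiKummerData h toB Q odd_l R ιX hopen σ K' constEmb constEmb_injective hdivc hdivp).BiKummerDifferenceMem)
    (hT : α.inv ≫ Ψ.functor.map (ofBiKummerData h toB Q odd_l R ιX hopen σ K' constEmb constEmb_injective hdivc hdivp).sCap ≫ β.hom =
      eA.hom ≫ (ofBiKummerData h toB Q odd_l R ιX hopen σ K' constEmb constEmb_injective hdivc hdivp).sCap ≫ (1 : Aut (ofBiKummerData h toB Q odd_l R ιX hopen σ K' constEmb constEmb_injective hdivc hdivp).BN).hom)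
    (hT' : α.inv ≫ Ψ.functor.map (ofBiKummerData h toB Q odd_l R ιX hopen σ K' constEmb constEmb_injective hdivc hdivp).sCup ≫ β.hom =
      eA.hom ≫ (ofBiKummerData h toB Q odd_l R ιX hopen σ K' constEmb constEmb_injective hdivc hdivp).sCup ≫ Dp.hom)
    (hu : Dp ∈ (ofBiKummerData h toB Q odd_l R ιX hopen σ K' constEmb constEmb_injective hdivc hdivp).units (ofBiKummerData h toB Q odd_l R ιX hopen σ K' constEmb constEmb_injective hdivc hdivp).BN)
    (hstrv : (ofBiKummerData h toB Q odd_l R ιX hopen σ K' constEmb constEmb_injective hdivc hdivp).StrvTransport Ψ α eA θΨ)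
    (hYdd : (ofBiKummerData h toB Q odd_l R ιX hopen σ K' constEmb constEmb_injective hdivc hdivp).HB.map θΨ.toMonoidHom = (ofBiKummerData h toB Q odd_l R ιX hopen σ K' constEmb constEmb_injective hdivc hdivp).HB)
    (P : ThetaSubquotientProjGalois (ofBiKummerData h toB Q odd_l R ιX hopen σ K' constEmb constEmb_injective hdivc hdivp) Gal)
    (hσ : ∀ g : Aut R.AN.base, ModelFrobenioid.baseMap (σ g).hom = g.hom)
    (hgeom : P.pre R.BN.base ≤ RD.aug.ker.map (rhoOfBiKummerData R ιX))
    (hconst : ∀ δ ∈ RD.aug.ker, ∀ τ : ModelFrobenioid.units R.BN,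
      (S.tf.ratFnFunctor.map (rhoOfBiKummerData R ιX δ).hom.op).hom (ModelFrobenioid.unit τ.1.hom) =
        ModelFrobenioid.unit τ.1.hom)
    (e : RD.mu → (ofBiKummerData h toB Q odd_l R ιX hopen σ K' constEmb constEmb_injective hdivc hdivp).lDeltaModN (ofBiKummerData h toB Q odd_l R ιX hopen σ K' constEmb constEmb_injective hdivc hdivp).BN)
    (he : Function.Surjective e)
    (hpre : ∀ k : RD.PiYdd, (k : RD.PiX) ∈ RD.lDeltaTheta → rhoOfBiKummerData R ιX k ∈ P.pre _)
    (hP : ∀ (k : RD.PiYdd) (hk : (k : RD.PiX) ∈ RD.lDeltaTheta) (hm : rhoOfBiKummerData R ιX k ∈ P.pre _),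
      (QuotientGroup.mk (P.proj _ ⟨rhoOfBiKummerData R ιX k, hm⟩) : (ofBiKummerData h toB Q odd_l R ιX hopen σ K' constEmb constEmb_injective hdivc hdivp).lDeltaModN (ofBiKummerData h toB Q odd_l R ιX hopen σ K' constEmb constEmb_injective hdivc hdivp).BN) = e (RD.thetaMod ⟨k, hk⟩))
    (hcov' : ∀ g ∈ P.pre ((ofBiKummerData h toB Q odd_l R ιX hopen σ K' constEmb constEmb_injective hdivc hdivp).base.obj (ofBiKummerData h toB Q odd_l R ιX hopen σ K' constEmb constEmb_injective hdivc hdivp).BN),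
      ∃ k : RD.PiYdd, (k : RD.PiX) ∈ RD.lDeltaTheta ∧ rhoOfBiKummerData R ιX k = g)
    (γ : RD.PiX ≃ₜ* RD.PiX)
    (hγ : ∀ y : RD.PiX, θΨ (rhoOfBiKummerData R ιX y) = rhoOfBiKummerData R ιX (γ y))
    (hγL : RD.lDeltaTheta.map γ.toMulEquiv.toMonoidHom = RD.lDeltaTheta)
    (haΨ : ∀ (k : RD.PiYdd) (hk : (k : RD.PiX) ∈ RD.lDeltaTheta) (hk' : γ k ∈ RD.lDeltaTheta),
      (ofBiKummerData h toB Q odd_l R ιX hopen σ K' constEmb constEmb_injective hdivc hdivp).lDeltaModNMap β.hom (aΨ _ (e (RD.thetaMod ⟨k, hk⟩))) = e (RD.thetaMod ⟨γ k, hk'⟩))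
    (ρ : RigidityFamily (ofBiKummerData h toB Q odd_l R ιX hopen σ K' constEmb constEmb_injective hdivc hdivp))
    (hB : (ofBiKummerData h toB Q odd_l R ιX hopen σ K' constEmb constEmb_injective hdivc hdivp).IsThetaSaturated (ofBiKummerData h toB Q odd_l R ιX hopen σ K' constEmb constEmb_injective hdivc hdivp).BN)
    (hK : P.IsKummerDetermined ρ hB) (hρ : IsFunctorialLinear (ofBiKummerData h toB Q odd_l R ιX hopen σ K' constEmb constEmb_injective hdivc hdivp) ρ) :
    CyclotomicRigidityPreserved (ofBiKummerData h toB Q odd_l R ιX hopen σ K' constEmb constEmb_injective hdivc hdivp) Ψ ρ aΨ := by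
  haveI : Epi (ofBiKummerData h toB Q odd_l R ιX hopen σ K' constEmb constEmb_injective hdivc hdivp).sCap := epi_of_model (DivB := S.tf.divBNatTrans) h _
  haveI : Epi (ofBiKummerData h toB Q odd_l R ιX hopen σ K' constEmb constEmb_injective hdivc hdivp).sCup := epi_of_model (DivB := S.tf.divBNatTrans) h _
  exact Thm56Sub.cyclotomicRigidityPreserved_of_sub_galois Ψ α β eA Dp θΨ Ψbs eΨ aΨ ρ hB hreach hρ hlin haΨn hpull
    (sgpCapSpec_ofBiKummerData h toB Q odd_l R ιX hopen σ K' constEmb constEmb_injective hdivc hdivp)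
    (sgpCupSpec_ofBiKummerData h toB Q odd_l R ιX hopen σ K' constEmb constEmb_injective hdivc hdivp)
    hdiff hT hT' hu hstrv hYdd P
    (unitsCentralUnderLDelta_ofBiKummerData_galois h toB Q odd_l R ιX hopen σ K' constEmb constEmb_injective hdivc hdivp
      hσ P hgeom hconst)
    (unitsPullSpec_ofBiKummerData h toB Q odd_l R ιX hopen σ K' constEmb constEmb_injective hdivc hdivp)
    (Thm56Sub.deltaTransportCompat_ofBiKummerData_galois h toB Q odd_l R ιX hopen σ K' constEmb constEmb_injective hdivc hdivp
      e P hpre hP hcov' Ψ β aΨ θΨ γ hγ hγL haΨ)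
    hK
    (lDeltaCovered_ofBiKummerData_galois h toB Q odd_l R ιX hopen σ K' constEmb constEmb_injective hdivc hdivp e he P hpre hP)

end ThetaFrobenioid

end Literature.AnabelianGeometry.EtaleTheta

end
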